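import Literature.NumberTheory.EllipticCurves.ZpExtensionEisensteinDVRSetting
import Literature.NumberTheory.EllipticCurves.ZpExtensionEisensteinTwistRestrictedDualityInstanceProofs
import Literature.NumberTheory.EllipticCurves.ZpExtensionEisensteinTwistDualityFormNondegenerateProofs
import Literature.NumberTheory.EllipticCurves.TorsionFilAtConjugatePairingMultiplicativeThreeProofs
import HarnessLib

/-!
# `hOrth` of H.4 at a place `v ∣ 3` of MULTIPLICATIVE reduction for the Weil–τ H.4 data (theorems only — no definition, no named fact,
# no instance, no `sorry`)

Topic `NumberTheory/EllipticCurves` (LEAD `bsd-wall-utd-p1`, crux r205 stmt-BirchSwinnertonDyer-24737 `TwinAlgMuZeroAtThree`,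
line `beta-road`, stub `stub_howardOutputsOfFamily`, E2 assembly at `v ∣ 3`).  Cell x9's
`ZpExtensionEisensteinDVRSettingH4OrdinaryIsotropyProofs.eisensteinTower_orthogonal_twistedFil_of_e_eq` (the `hOrth` input of
`eisensteinTower_isSelfOrthogonalAt_of_mem` for the instantiated H.4 data) assumes `IsOrdinaryAt W p` (good ordinary), used only via
the perfectness lemma; for places of MULTIPLICATIVE reduction above `3` that lemma is
`TorsionFilAtConjugatePairingMultiplicativeThreeProofs.eisensteinDualityForm_torsionFilAt_restricted_perfect_of_hasMultiplicativeReductionAt_three`.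
This file: x9's statement and proof at `p = 3` with `hordW` replaced by `hmult`.  BSD is not proved by any of this.

References: [Howard2004HeegnerKolyvagin] Lemma 3.1.1, §1.3 H.4; [SilvermanAEC2009] III.8.1, VII.2.2.
-/

set_option autoImplicit false

noncomputable section

open Function NumberField IsDedekindDomain Field CategoryTheory
open scoped NumberField ContRepresentation TensorProduct Classical

namespace WeierstrassCurve

open Literature.NumberTheory.EllipticCurves Literature.NumberTheory.GaloisRepresentations
open Literature.NumberTheory.GaloisRepresentations.DiscreteGaloisModule
open Literature.NumberTheory.GaloisCohomology Literature.NumberTheory.GaloisCohomology.Howard2004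
open Literature.NumberTheory.EllipticCurves.ZpExtension (EisensteinLevel)

variable {K : Type} [Field K] [NumberField K] (W : WeierstrassCurve ℚ) [W.IsElliptic]
  (κ : ZpExtension K 3) {m : ℕ} (hm : 1 ≤ m)
  (σ : K ≃ₐ[ℚ] K) (hσ₁ : σ ≠ 1) (hσ : σ * σ = 1) (τ : AlgebraicClosure K ≃+* AlgebraicClosure K)
  (hτl : IsLiftOfAut σ τ) (hτ₂ : Function.Involutive τ)

set_option maxHeartbeats 800000 in
/-- **`hOrth` for the Weil–τ H.4 data at a place `v ∣ 3` of MULTIPLICATIVE reduction** (x9's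
`eisensteinTower_orthogonal_twistedFil_of_e_eq` with `IsOrdinaryAt W p` replaced by multiplicative reduction at `v`; original docstring:)
**`hOrth` for the Weil–τ H.4 data at `v ∣ p`.**  Let `E/ℚ` be globally minimal with good ordinary reduction at `p`
(`IsOrdinaryAt W p`), `cd := ConjugationDatum.ofLifts σ … τ …`, and `D k` H.4 data on `T^{(k)}` with
`(D k).e = eisensteinDualityForm hm (k+1) (conjPairing (e (k+1)) τ_* (log (k+1)))` for an alternating Weil family `e`, bijective
logarithms `log` and involutive `τ_*`.  Then for every `v ∣ p` and every `j`, `(D j).e s (δ_v · s′) = 0` for `s` in the twisted plus part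
`A ⊗ Fil_v` and `s′` in `A ⊗ Fil_{σ v}` at level `j+1` — the hypothesis `hOrth` of `eisensteinTower_isSelfOrthogonalAt_of_mem`.
[cite: Howard2004HeegnerKolyvagin, Lemma 3.1.1 and §1.3 H.4 (arXiv p. 7 L69–82, p. 15 L60–62)] [cite: SilvermanAEC2009, III.8.1 and VII.2.2] -/
theorem eisensteinTower_orthogonal_twistedFil_of_e_eq_of_hasMultiplicativeReductionAt_three
    (D' : letI := IwasawaAlgebra.isLocalRing_quotient_X_pow_add_C 3 hm
      ∀ k, DualityDatum 3 (ConjugationDatum.ofLifts σ hσ₁ hσ τ hτl hτ₂) ((W.eisensteinTower κ hm).ρ k)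
        (IwasawaAlgebra.EisensteinCoeff 3 m (k + 1)))
    (e : ∀ j : ℕ, geomTorsion (W.baseChange K) (((3 : ℕ) : ℤ) ^ j) →+ geomTorsion (W.baseChange K) (((3 : ℕ) : ℤ) ^ j) →+
      MuCarrier K (3 ^ j))
    (log : ∀ j : ℕ, MuCarrier K (3 ^ j) →+ ZMod (3 ^ j))
    (hDe : letI := IwasawaAlgebra.isLocalRing_quotient_X_pow_add_C 3 hm
      ∀ k, (D' k).e = ZpExtension.eisensteinDualityForm hm (k + 1)
        (conjPairing (e (k + 1)) ((ConjugationDatum.ofLifts σ hσ₁ hσ τ hτl hτ₂).isLift.torsionMap W _) (log (k + 1))))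
    (halt : ∀ j a, e j a a = 0) (hlog : ∀ j, Function.Bijective (log j))
    (hθθ : ∀ j (a : geomTorsion (W.baseChange K) (((3 : ℕ) : ℤ) ^ j)),
      (ConjugationDatum.ofLifts σ hσ₁ hσ τ hτl hτ₂).isLift.torsionMap W _
        ((ConjugationDatum.ofLifts σ hσ₁ hσ τ hτl hτ₂).isLift.torsionMap W _ a) = a)
    {v : HeightOneSpectrum (𝓞 K)} (hpv : ((3 : ℕ) : 𝓞 K) ∈ v.asIdeal) (hmult : (W.baseChange K).HasMultiplicativeReductionAt v) :
    letI := IwasawaAlgebra.isLocalRing_quotient_X_pow_add_C 3 hm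
    ∀ j, ∀ s ∈ ((W.baseChange K).ordinaryFiltrationAt v (fun j ↦ (W.baseChange K).torsionGaloisModuleReduce 3 j)
        (fun _ _ ↦ rfl)).twistedFil (m := m) (j + 1),
      ∀ s' ∈ ((W.baseChange K).ordinaryFiltrationAt ((ConjugationDatum.ofLifts σ hσ₁ hσ τ hτl hτ₂).σ • v)
        (fun j ↦ (W.baseChange K).torsionGaloisModuleReduce 3 j) (fun _ _ ↦ rfl)).twistedFil (m := m) (j + 1),
        (D' j).e s ((κ.eisensteinTwist ((W.baseChange K).torsionGaloisModule (((3 : ℕ) : ℤ) ^ (j + 1))) hm (j + 1))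
          ((ConjugationDatum.ofLifts σ hσ₁ hσ τ hτl hτ₂).δ v) s') = 0 := by
  letI := IwasawaAlgebra.isLocalRing_quotient_X_pow_add_C 3 hm
  intro j s hs s' hs'
  -- non-degeneracy of the Weil family from `D.perfect`
  have hnd := (W.weilLog_nondegenerate_of_dualityDatum_e_eq κ hm (ConjugationDatum.ofLifts σ hσ₁ hσ τ hτl hτ₂) j (D' j)
    (e (j + 1)) (log (j + 1)) (hDe j) (hθθ (j + 1))).2.2.2.2.2.2
  -- the restricted isotropy clause of the Weil–τ form on `(A ⊗ Fil_v) × (A ⊗ δ_v Fil_{σv})`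
  obtain ⟨horth, -, -⟩ := W.eisensteinDualityForm_torsionFilAt_restricted_perfect_of_hasMultiplicativeReductionAt_three hm σ hσ₁
    hσ τ hτl hτ₂ v hmult hpv (j + 1) (e (j + 1)) (log (j + 1)) (hlog (j + 1)).1 (halt (j + 1)) hnd (hθθ (j + 1))
  rw [hDe j]
  refine horth s hs _ ?_
  -- `δ_v · s′` lies in `A ⊗ δ_v Fil_{σv}`
  have key := κ.map_eisensteinTwist_span_tmul ((W.baseChange K).torsionGaloisModule (((3 : ℕ) : ℤ) ^ (j + 1))) hm (j + 1)
    ((W.baseChange K).torsionFilAt ((ConjugationDatum.ofLifts σ hσ₁ hσ τ hτl hτ₂).σ • v) (((3 : ℕ) : ℤ) ^ (j + 1)))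
    ((ConjugationDatum.ofLifts σ hσ₁ hσ τ hτl hτ₂).δ v)
  have hmem : (κ.eisensteinTwist ((W.baseChange K).torsionGaloisModule (((3 : ℕ) : ℤ) ^ (j + 1))) hm (j + 1)
        ((ConjugationDatum.ofLifts σ hσ₁ hσ τ hτl hτ₂).δ v)) s' ∈
      (Submodule.span ℤ {x | ∃ (c : IwasawaAlgebra.EisensteinCoeff 3 m (j + 1))
          (a : geomTorsion (W.baseChange K) (((3 : ℕ) : ℤ) ^ (j + 1))),
          a ∈ (W.baseChange K).torsionFilAt ((ConjugationDatum.ofLifts σ hσ₁ hσ τ hτl hτ₂).σ • v) (((3 : ℕ) : ℤ) ^ (j + 1)) ∧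
            x = IwasawaAlgebra.EisensteinCoeff.Twisted.tmul c a}).map
        (κ.eisensteinTwist ((W.baseChange K).torsionGaloisModule (((3 : ℕ) : ℤ) ^ (j + 1))) hm (j + 1)
          ((ConjugationDatum.ofLifts σ hσ₁ hσ τ hτl hτ₂).δ v)) :=
    Submodule.mem_map_of_mem hs'
  rw [key] at hmem
  exact hmem

end WeierstrassCurve

end
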